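import Literature.NumberTheory.Sieve.DivisorBound
import Mathlib.Analysis.SpecialFunctions.Pow.Real
import Mathlib.Analysis.SpecialFunctions.Log.Basic
import Mathlib.Analysis.SpecialFunctions.Sqrt
import Mathlib.NumberTheory.Harmonic.Bounds
import HarnessLib

/-!
# Grimmelt–Merikoski 2025, Proposition 4.2 in the Type I case: the diagonal kernel sum `∑_{q ≤ Q} ∑_{γ ∈ Γ₀(q)} k⁺(u_R(γ))`

L. Grimmelt, J. Merikoski, *On the greatest prime factor and uniform equidistribution of quadratic
polynomials*, arXiv:2505.00493 [GrimmeltMerikoski2025].  The proof of the Type I estimate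
(Theorem 1.4, vendored as the named fact
`Literature.NumberTheory.Sieve.grimmeltMerikoski2025_thm14_restricted`) in §5 of the paper applies
the technical Theorem 2.1 (= [GMtechnical, Thm 8.1]) and is left with two "kernel" quantities,
`K₁ = ∑_{d ≤ D} ⟨I|Δ_{ad} k_{Z₁²,𝐗}|I⟩ ≤ ∑_{q ≤ aD} ⟨I|𝒦_q k_{Z₁²,𝐗}|I⟩` and `K₂` (Heegner
functionals), bounded by Propositions 4.2 and 4.1 respectively.  Since `I` is the point mass at
the identity and `𝒦_q F(τ₁, τ₂) = ∑_{γ ∈ Γ₀(q)} F(τ₁⁻¹γτ₂)`, the first is the plain sum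
`∑_{q ≤ Q} ∑_{γ ∈ Γ₀(q)} k(γ)` over the Hecke congruence subgroups, and the kernels of Theorem 2.1
satisfy `0 ≤ k_{Z,R}(γ) ≤ k⁺_Z(u_R(γ)) := 𝟙{u_R(γ) ≤ Z}/√(1 + u_R(γ))` with the `R`-skewed size
`u_R(γ) = ¼(a² + (b/R)² + (cR)² + d² − 2)` (§2).  This file PROVES the bound the paper uses for it,

  `∑_{q ≤ Q} ∑_{γ ∈ Γ₀(q)} k⁺_Z(u_R(γ)) ≪_ε ((2+Z)(2+R+R⁻¹))^ε · (Q(1 + R) + R⁻¹ + Z^{1/2})`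

(`exists_sum_kernelDiagSum_le`) — Proposition 4.2 specialised to `β = I`
(`D = N₀ = N₂ = T = V = 1`: "the bound simplifies to `V²(R⁻¹ + Z^{1/2}) + (1+R)(V²N + VN²)`"),
which is (K1bound) of §5, `K₁ ≺≺ D(1 + 𝐗) + 𝐗⁻¹ + Z₁`, with `Q = aD`, `R = 𝐗`, `Z = Z₁²`.
The proof is the case analysis of §4.2 of the paper at `v = v' = 0`, written arithmetically
(the `γ` are the integer points `ad − bc = 1` of a box `[-N, N]⁴`, all bounds uniform in `N`):

* `GM2025.sl2Box`, `GM2025.uR`, `GM2025.kPlus`, `GM2025.kernelDiagSum q R Z N` (definitions);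
* `sum_Icc_kernelDiagSum_eq` — `∑_q ∑_{γ : q ∣ c} = ∑_γ k⁺ · #{q ≤ Q : q ∣ c}`, the multiplicity
  being `≤ Q` (`c = 0`) or `≤ τ(|c|)` (`card_filter_dvd_le`);
* `sum_c_eq_zero_le` — `c = 0` (§4.2.4): `a = d = ±1`, `∑_b k⁺((b/R)²/4) ≪ (1 + R) log`, total
  `≪ Q(1+R) log`;
* `sum_b_eq_zero_le` — `c ≠ 0 = b` (§4.2.1, `b' = 0`): `∑_c τ(|c|) · 2/(|c|R) ≪ R⁻¹ Z^{o(1)}`;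
* `sum_bc_ne_zero_le` — `bc = ad − 1 ≠ 0` (§4.2.1, off-diagonal): the divisor bound absorbs the
  level and the factorisations `bc = ad − 1`, leaving `∑_{a,d ≪ √Z} (|a|+|d|+1)⁻¹ ≪ Z^{1/2+o(1)}`;
* `exists_sum_kernelDiagSum_le` — the assembled bound (divisor bound `τ(n) ≤ C_η n^η`,
  `Literature.NumberTheory.Sieve.exists_card_divisors_le_mul_rpow'`, with `η = min(ε,1)/4`).

Nothing here uses or touches the deep input of the paper (Theorem 2.1); it is one of the
elementary ingredients of §5 (layer "Prop 4.2 (Type I)" of the tree's formalisation of §§4–5 of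
the paper around the named fact `grimmeltMerikoski2025_thm14_restricted`).  The identification of
`kernelDiagSum` with `⟨I|𝒦_q k⁺|I⟩ = automorphicKernel Γ₀(q) k⁺ (iR) (iR)`
(`u_R(γ) = u(γ·iR, iR)`, `Literature.NumberTheory.Automorphic.automorphicKernel`) belongs to the
assembly layer and is not needed here.

## References

* [GrimmeltMerikoski2025] arXiv:2505.00493: §2 (u_R, k_{Y,R} ≤ 𝟙{u_R ≤ Y}/√(1+u_R)),
  Proposition 4.2 and its proof §4.2 (cases c' = 0 / b' = 0 / b'c' ≠ 0), §5 (K₁, (K1bound)).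
-/

noncomputable section

namespace Literature.NumberTheory.Sieve

open Finset Real

namespace GM2025

/-- The integer points `((a, b), (c, d))` of the box `[-N, N]⁴` on the determinant surface
`ad - bc = 1` (the entries of the `γ ∈ SL₂(ℤ)` in the box). [folklore] -/
def sl2Box (N : ℕ) : Finset ((ℤ × ℤ) × (ℤ × ℤ)) :=
  (((Icc (-(N : ℤ)) N) ×ˢ (Icc (-(N : ℤ)) N)) ×ˢ ((Icc (-(N : ℤ)) N) ×ˢ (Icc (-(N : ℤ)) N))).filter
    fun p => p.1.1 * p.2.2 - p.1.2 * p.2.1 = 1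

/-- The `R`-skewed hyperbolic size `u_R(γ) = ¼ (a² + (b/R)² + (cR)² + d² − 2)` of
`γ = (a b; c d)` ([GrimmeltMerikoski2025, §2, display before Theorem 2.1]), on integer entries.
[cite: GrimmeltMerikoski2025, §2 (definition of u_R)] -/
def uR (R : ℝ) (p : (ℤ × ℤ) × (ℤ × ℤ)) : ℝ :=
  ((p.1.1 : ℝ) ^ 2 + ((p.1.2 : ℝ) / R) ^ 2 + ((p.2.1 : ℝ) * R) ^ 2 + (p.2.2 : ℝ) ^ 2 - 2) / 4

/-- The majorant `k⁺_Z(u) = 𝟙{u ≤ Z} / √(1 + u)` of the kernels `k_{Z,R}` of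
[GrimmeltMerikoski2025, Theorem 2.1] ("certain smooth functions `k_{Y,R} : G → [0,1]` which satisfy
`k_{Y,R}(g) ≤ 𝟙{u_R(g) ≤ Y}/√(1 + u_R(g))`"), as a function of `u = u_R(g)`.
[cite: GrimmeltMerikoski2025, Theorem 2.1 (last display)] -/
def kPlus (Z u : ℝ) : ℝ := if u ≤ Z then (Real.sqrt (1 + u))⁻¹ else 0

/-- **The level-`q` diagonal kernel sum** `∑_{γ ∈ Γ₀(q)} k⁺_Z(u_R(γ))` — the quantity
`⟨I | 𝒦_q k | I⟩` (`I` the point mass at the identity, `𝒦_q` the automorphic kernel of `Γ₀(q)`)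
bounding `K₁` in [GrimmeltMerikoski2025, §5], written arithmetically as a sum over the integer
points `ad - bc = 1`, `q ∣ c` of the box `[-N, N]⁴` (the sum over all of `Γ₀(q)` is finite, the
support `u_R ≤ Z` being bounded; every bound below is uniform in `N`).
[cite: GrimmeltMerikoski2025, §5 (definition of K₁) and Proposition 4.2] -/
def kernelDiagSum (q : ℕ) (R Z : ℝ) (N : ℕ) : ℝ :=
  ∑ p ∈ (sl2Box N).filter (fun p => (q : ℤ) ∣ p.2.1), kPlus Z (uR R p)

/-! ### Basic properties -/

/-- Membership in `sl2Box`. [folklore] -/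
theorem mem_sl2Box {N : ℕ} {p : (ℤ × ℤ) × (ℤ × ℤ)} :
    p ∈ sl2Box N ↔ ((-(N : ℤ) ≤ p.1.1 ∧ p.1.1 ≤ N) ∧ (-(N : ℤ) ≤ p.1.2 ∧ p.1.2 ≤ N)) ∧
      ((-(N : ℤ) ≤ p.2.1 ∧ p.2.1 ≤ N) ∧ (-(N : ℤ) ≤ p.2.2 ∧ p.2.2 ≤ N)) ∧
      p.1.1 * p.2.2 - p.1.2 * p.2.1 = 1 := by
  simp only [sl2Box, mem_filter, mem_product, mem_Icc, and_assoc]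

/-- `a² + (b/R)² + (cR)² + d² ≥ 2` on `ad - bc = 1`:
the difference is `(a - d)² + (b/R + cR)²`. [folklore] -/
theorem two_le_of_det_eq_one {R : ℝ} (hR : 0 < R) {a b c d : ℝ} (h : a * d - b * c = 1) :
    2 ≤ a ^ 2 + (b / R) ^ 2 + (c * R) ^ 2 + d ^ 2 := by
  have h1 : (b / R) * (c * R) = b * c := by field_simp
  nlinarith [sq_nonneg (a - d), sq_nonneg (b / R + c * R)]

/-- `u_R(γ) ≥ 0` on `SL₂(ℤ)`. [folklore] -/
theorem uR_nonneg {R : ℝ} (hR : 0 < R) {N : ℕ} {p : (ℤ × ℤ) × (ℤ × ℤ)} (hp : p ∈ sl2Box N) :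
    0 ≤ uR R p := by
  have hdet := (mem_sl2Box.mp hp).2.2
  have hdet' : (p.1.1 : ℝ) * p.2.2 - p.1.2 * p.2.1 = 1 := by exact_mod_cast hdet
  have := two_le_of_det_eq_one hR hdet'
  unfold uR
  linarith

/-- `k⁺ ≥ 0`. [folklore] -/
theorem kPlus_nonneg (Z u : ℝ) : 0 ≤ kPlus Z u := by
  unfold kPlus
  split_ifs
  · exact inv_nonneg.mpr (Real.sqrt_nonneg _)
  · exact le_rfl

/-- `k⁺_Z(u) = 0` for `u > Z`. [folklore] -/
theorem kPlus_eq_zero_of_lt {Z u : ℝ} (h : Z < u) : kPlus Z u = 0 := by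
  unfold kPlus
  rw [if_neg (not_le.mpr h)]

/-- `k⁺_Z(u) ≤ 1/√(1 + u)`. [folklore] -/
theorem kPlus_le_inv_sqrt {Z u : ℝ} : kPlus Z u ≤ (Real.sqrt (1 + u))⁻¹ := by
  unfold kPlus
  split_ifs
  · exact le_rfl
  · exact inv_nonneg.mpr (Real.sqrt_nonneg _)

/-- `k⁺_Z(u) ≤ 1` for `u ≥ 0`. [folklore] -/
theorem kPlus_le_one {Z u : ℝ} (hu : 0 ≤ u) : kPlus Z u ≤ 1 := by
  refine kPlus_le_inv_sqrt.trans ?_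
  rw [inv_le_one_iff₀]
  right
  rw [Real.one_le_sqrt]
  linarith

/-- If `t²/4 ≤ u` with `t > 0` then `k⁺_Z(u) ≤ 2/t`. [folklore] -/
theorem kPlus_le_two_div {Z u t : ℝ} (ht : 0 < t) (hu : t ^ 2 / 4 ≤ u) : kPlus Z u ≤ 2 / t := by
  refine kPlus_le_inv_sqrt.trans ?_
  have h1 : t / 2 ≤ Real.sqrt (1 + u) := by
    rw [Real.le_sqrt (by linarith) (by nlinarith)]
    nlinarith
  rw [inv_le_comm₀ (lt_of_lt_of_le (by positivity) h1) (by positivity)]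
  rw [inv_div]
  exact h1

/-! ### Multiplicities of the level -/

/-- For `c ≠ 0`, the number of levels `q ≤ Q` dividing `c` is at most `τ(|c|)`. [folklore] -/
theorem card_filter_dvd_le (Q : ℕ) {c : ℤ} (hc : c ≠ 0) :
    #((Icc 1 Q).filter (fun q : ℕ => (q : ℤ) ∣ c)) ≤ #(c.natAbs.divisors) := by
  refine card_le_card fun q hq => ?_
  rw [mem_filter, mem_Icc] at hq
  rw [Nat.mem_divisors]
  exact ⟨Int.natCast_dvd.mp hq.2, Int.natAbs_ne_zero.mpr hc⟩

/-- Trivially at most `Q` levels `q ≤ Q` divide `c`. [folklore] -/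
theorem card_filter_dvd_le' (Q : ℕ) (c : ℤ) :
    #((Icc 1 Q).filter (fun q : ℕ => (q : ℤ) ∣ c)) ≤ Q :=
  (card_filter_le _ _).trans (by simp)

/-- Interchanging the sum over the level with the sum over the matrices:
`∑_{q ≤ Q} ∑_{γ : q ∣ c} k(γ) = ∑_γ k(γ) · #{q ≤ Q : q ∣ c}`. [folklore] -/
theorem sum_Icc_kernelDiagSum_eq (Q : ℕ) (R Z : ℝ) (N : ℕ) :
    ∑ q ∈ Icc 1 Q, kernelDiagSum q R Z N =
      ∑ p ∈ sl2Box N, kPlus Z (uR R p) * #((Icc 1 Q).filter (fun q : ℕ => (q : ℤ) ∣ p.2.1)) := by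
  unfold kernelDiagSum
  simp_rw [sum_filter]
  rw [sum_comm]
  refine sum_congr rfl fun p _ => ?_
  rw [← sum_filter, sum_const, nsmul_eq_mul, mul_comm]

/-! ### Harmonic-type sums over symmetric integer intervals -/

/-- `∑_{1 ≤ n ≤ M} 1/n ≤ 1 + log(M + 1)`. [folklore] -/
theorem sum_Icc_inv_le_log (M : ℕ) :
    ∑ n ∈ Icc 1 M, ((n : ℝ))⁻¹ ≤ 1 + Real.log (M + 1) := by
  have h1 : (∑ n ∈ Icc 1 M, ((n : ℝ))⁻¹) = (harmonic M : ℝ) := by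
    rw [harmonic_eq_sum_Icc]
    push_cast
    rfl
  rw [h1]
  refine (harmonic_le_one_add_log M).trans ?_
  rcases Nat.eq_zero_or_pos M with rfl | hM
  · simp
  · have : Real.log M ≤ Real.log (M + 1) :=
      Real.log_le_log (by exact_mod_cast hM) (by linarith)
    linarith

/-- `∑_{-M ≤ b ≤ M} g(b) = g(0) + ∑_{1 ≤ n ≤ M} (g(n) + g(-n))`. [folklore] -/
theorem sum_Icc_neg_eq (g : ℤ → ℝ) (M : ℕ) :
    ∑ b ∈ Icc (-(M : ℤ)) M, g b = g 0 + ∑ n ∈ Icc 1 M, (g n + g (-(n : ℤ))) := by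
  induction M with
  | zero => simp
  | succ M ih =>
    have hdecomp : Icc (-((M + 1 : ℕ) : ℤ)) ((M + 1 : ℕ) : ℤ) =
        insert (-((M + 1 : ℕ) : ℤ)) (insert ((M + 1 : ℕ) : ℤ) (Icc (-(M : ℤ)) M)) := by
      ext b
      simp only [mem_Icc, mem_insert]
      omega
    have h1 : ((M + 1 : ℕ) : ℤ) ∉ Icc (-(M : ℤ)) M := by simp
    have h2 : -((M + 1 : ℕ) : ℤ) ∉ insert ((M + 1 : ℕ) : ℤ) (Icc (-(M : ℤ)) M) := by
      simp only [mem_insert, mem_Icc]; omega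
    rw [hdecomp, sum_insert h2, sum_insert h1, ih, sum_Icc_succ_top (by omega : 1 ≤ M + 1)]
    push_cast
    ring

/-- `∑_{-M ≤ b ≤ M} 1/(|b| + 1) ≤ 3 (1 + log(M + 1))`. [folklore] -/
theorem sum_Icc_inv_abs_add_one_le (M : ℕ) :
    ∑ b ∈ Icc (-(M : ℤ)) M, (|(b : ℝ)| + 1)⁻¹ ≤ 3 * (1 + Real.log (M + 1)) := by
  rw [sum_Icc_neg_eq (fun b : ℤ => (|(b : ℝ)| + 1)⁻¹) M]
  have hlog : 0 ≤ Real.log (M + 1) := Real.log_nonneg (by linarith [(Nat.cast_nonneg M : (0:ℝ) ≤ M)])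
  have hpair : ∀ n ∈ Icc 1 M, (|((n : ℤ) : ℝ)| + 1)⁻¹ + (|((-(n : ℤ) : ℤ) : ℝ)| + 1)⁻¹ ≤ 2 * ((n : ℝ))⁻¹ := by
    intro n hn
    rw [mem_Icc] at hn
    have hn1 : (1 : ℝ) ≤ n := by exact_mod_cast hn.1
    have e1 : |((n : ℤ) : ℝ)| = n := by push_cast; exact abs_of_nonneg (by linarith)
    have e2 : |((-(n : ℤ) : ℤ) : ℝ)| = n := by push_cast; rw [abs_neg]; exact abs_of_nonneg (by linarith)
    rw [e1, e2, two_mul]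
    have : ((n : ℝ) + 1)⁻¹ ≤ ((n : ℝ))⁻¹ := inv_anti₀ (by linarith) (by linarith)
    linarith
  have hsum := sum_le_sum hpair
  rw [← mul_sum] at hsum
  have h0 : (|((0 : ℤ) : ℝ)| + 1)⁻¹ = 1 := by simp
  rw [h0]
  have := sum_Icc_inv_le_log M
  nlinarith

/-- Restricting a non-negative sum with the cut-off `|b| ≤ B` to the symmetric interval
`[-⌊B⌋, ⌊B⌋]`. [folklore] -/
theorem sum_ite_abs_le_le {g : ℤ → ℝ} (hg : ∀ b, 0 ≤ g b) (B : ℝ) (S : Finset ℤ) :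
    ∑ b ∈ S, (if |(b : ℝ)| ≤ B then g b else 0) ≤ ∑ b ∈ Icc (-(⌊B⌋₊ : ℤ)) ⌊B⌋₊, g b := by
  rw [← sum_filter]
  rcases lt_or_ge B 0 with hB | hB
  · have : S.filter (fun b : ℤ => |(b : ℝ)| ≤ B) = ∅ := by
      refine filter_eq_empty_iff.mpr fun b _ h => ?_
      linarith [abs_nonneg (b : ℝ)]
    rw [this, sum_empty]
    exact sum_nonneg fun b _ => hg b
  refine sum_le_sum_of_subset_of_nonneg (fun b hb => ?_) fun b _ _ => hg b
  rw [mem_filter] at hb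
  have hbB := abs_le.mp hb.2
  have hfl : (b : ℤ) ≤ ⌊B⌋ := Int.le_floor.mpr hbB.2
  have hfl' : -⌊B⌋ ≤ (b : ℤ) := by
    have : ((-b : ℤ) : ℝ) ≤ B := by push_cast; linarith
    have := Int.le_floor.mpr this
    omega
  rw [mem_Icc, Int.natCast_floor_eq_floor hB]
  exact ⟨hfl', hfl⟩

/-! ### The terms with `c = 0` -/

/-- On the family `((s, b), (0, s))`, `s = ±1`: `u_R = (b/R)²/4`. [folklore] -/
theorem uR_upper (R : ℝ) {s : ℤ} (hs : s = 1 ∨ s = -1) (b : ℤ) :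
    uR R ((s, b), (0, s)) = ((b : ℝ) / R) ^ 2 / 4 := by
  have hs2 : (s : ℝ) ^ 2 = 1 := by
    rcases hs with rfl | rfl <;> norm_num
  unfold uR
  simp only [Int.cast_zero, zero_mul]
  linear_combination hs2 / 2

/-- Pointwise bound for the `c = 0` terms: `k⁺_Z((b/R)²/4) ≤ 𝟙{|b| ≤ 2R√Z} · 2(1 + 2R)/(|b| + 1)`.
[folklore] -/
theorem kPlus_upper_le {R Z : ℝ} (hR : 0 < R) (hZ : 0 ≤ Z) (b : ℤ) :
    kPlus Z (((b : ℝ) / R) ^ 2 / 4) ≤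
      if |(b : ℝ)| ≤ 2 * R * Real.sqrt Z then 2 * (1 + 2 * R) * (|(b : ℝ)| + 1)⁻¹ else 0 := by
  split_ifs with hb
  · have hb0 : 0 ≤ |(b : ℝ)| := abs_nonneg _
    rcases le_or_gt |(b : ℝ)| (2 * R) with hsmall | hlarge
    · refine (kPlus_le_one (by positivity)).trans ?_
      rw [le_mul_inv_iff₀ (by positivity)]
      nlinarith
    · have hbpos : 0 < |(b : ℝ)| := lt_of_le_of_lt (by positivity) hlarge
      have hb1 : 1 ≤ |(b : ℝ)| := by
        have : b ≠ 0 := by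
          rintro rfl
          simp at hbpos
        exact_mod_cast Int.one_le_abs this
      have ht : 0 < |(b : ℝ)| / R := div_pos hbpos hR
      have hu : (|(b : ℝ)| / R) ^ 2 / 4 ≤ ((b : ℝ) / R) ^ 2 / 4 := by
        rw [div_pow, div_pow, sq_abs]
      refine (kPlus_le_two_div ht hu).trans ?_
      rw [div_div_eq_mul_div, le_mul_inv_iff₀ (by positivity), div_mul_eq_mul_div,
        div_le_iff₀ hbpos]
      nlinarith
  · apply le_of_eq
    apply kPlus_eq_zero_of_lt
    have h1 : 2 * R * Real.sqrt Z < |(b : ℝ)| := not_le.mp hb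
    have h2 : (2 * R * Real.sqrt Z) ^ 2 < |(b : ℝ)| ^ 2 := by
      exact pow_lt_pow_left₀ h1 (by positivity) two_ne_zero
    rw [sq_abs] at h2
    have h3 : (2 * R * Real.sqrt Z) ^ 2 = 4 * R ^ 2 * Z := by
      rw [mul_pow, mul_pow, Real.sq_sqrt hZ]; ring
    rw [h3] at h2
    rw [div_pow, lt_div_iff₀ (by positivity), lt_div_iff₀ (by positivity)]
    nlinarith

/-- **The terms with `c = 0`**: `a = d = ±1`, every level `q ≤ Q` divides `c`, and
`∑_b k⁺_Z((b/R)²/4) ≪ (1 + R) log(2 + R√Z)`; in all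
`≤ Q · 2 · 2(1 + 2R) · 3(1 + log(⌊2R√Z⌋ + 1))`. [cite: GrimmeltMerikoski2025, §4.2.4 (diagonal, c' = 0) specialised to β = I] -/
theorem sum_c_eq_zero_le {R Z : ℝ} (hR : 0 < R) (hZ : 0 ≤ Z) (Q N : ℕ) :
    ∑ p ∈ (sl2Box N).filter (fun p => p.2.1 = 0),
        kPlus Z (uR R p) * #((Icc 1 Q).filter (fun q : ℕ => (q : ℤ) ∣ p.2.1)) ≤
      Q * (2 * (2 * (1 + 2 * R) * (3 * (1 + Real.log (⌊2 * R * Real.sqrt Z⌋₊ + 1))))) := by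
  set T := (sl2Box N).filter (fun p => p.2.1 = 0) with hT
  -- the parametrisation `(s, b) ↦ ((s, b), (0, s))`
  set φ : ℤ × ℤ → (ℤ × ℤ) × (ℤ × ℤ) := fun x => ((x.1, x.2), (0, x.1)) with hφ
  have hφinj : Function.Injective φ := by
    intro x y hxy
    simp only [hφ, Prod.mk.injEq] at hxy
    exact Prod.ext hxy.1.1 hxy.1.2
  set D := ({1, -1} : Finset ℤ) ×ˢ Icc (-(N : ℤ)) N with hD
  have hsub : T ⊆ D.image φ := by
    intro p hp
    rw [hT, mem_filter, mem_sl2Box] at hp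
    obtain ⟨⟨_, hb⟩, _, hdet⟩ := hp.1
    have hc : p.2.1 = 0 := hp.2
    rw [hc, mul_zero, sub_zero] at hdet
    rcases Int.eq_one_or_neg_one_of_mul_eq_one' hdet with ⟨ha, hd⟩ | ⟨ha, hd⟩
    · refine mem_image.mpr ⟨(1, p.1.2), ?_, ?_⟩
      · rw [hD, mem_product, mem_Icc]; exact ⟨by simp, hb⟩
      · rw [hφ]; ext <;> simp [ha, hd, hc]
    · refine mem_image.mpr ⟨(-1, p.1.2), ?_, ?_⟩
      · rw [hD, mem_product, mem_Icc]; exact ⟨by simp, hb⟩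
      · rw [hφ]; ext <;> simp [ha, hd, hc]
  -- Step 1: multiplicity ≤ Q and the parametrisation
  have hk0 : ∀ p, 0 ≤ kPlus Z (uR R p) := fun p => kPlus_nonneg _ _
  calc ∑ p ∈ T, kPlus Z (uR R p) * #((Icc 1 Q).filter (fun q : ℕ => (q : ℤ) ∣ p.2.1))
      ≤ ∑ p ∈ T, kPlus Z (uR R p) * Q := by
        refine sum_le_sum fun p _ => mul_le_mul_of_nonneg_left ?_ (hk0 p)
        exact_mod_cast card_filter_dvd_le' Q _
    _ = Q * ∑ p ∈ T, kPlus Z (uR R p) := by rw [mul_sum]; exact sum_congr rfl fun p _ => mul_comm _ _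
    _ ≤ Q * ∑ p ∈ D.image φ, kPlus Z (uR R p) :=
        mul_le_mul_of_nonneg_left (sum_le_sum_of_subset_of_nonneg hsub fun p _ _ => hk0 p)
          (Nat.cast_nonneg Q)
    _ = Q * ∑ x ∈ D, kPlus Z (uR R (φ x)) := by rw [sum_image fun x _ y _ h => hφinj h]
    _ = Q * ∑ s ∈ ({1, -1} : Finset ℤ), ∑ b ∈ Icc (-(N : ℤ)) N,
          kPlus Z (((b : ℝ) / R) ^ 2 / 4) := by
        rw [hD, sum_product]
        congr 1
        refine sum_congr rfl fun s hs => sum_congr rfl fun b _ => ?_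
        have hs' : s = 1 ∨ s = -1 := by simpa using hs
        rw [hφ]
        dsimp only
        rw [uR_upper R hs' b]
    _ ≤ Q * ∑ s ∈ ({1, -1} : Finset ℤ),
          (2 * (1 + 2 * R) * (3 * (1 + Real.log (⌊2 * R * Real.sqrt Z⌋₊ + 1)))) := by
        gcongr with s hs
        calc ∑ b ∈ Icc (-(N : ℤ)) N, kPlus Z (((b : ℝ) / R) ^ 2 / 4)
            ≤ ∑ b ∈ Icc (-(N : ℤ)) N, (if |(b : ℝ)| ≤ 2 * R * Real.sqrt Z then
                2 * (1 + 2 * R) * (|(b : ℝ)| + 1)⁻¹ else 0) :=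
              sum_le_sum fun b _ => kPlus_upper_le hR hZ b
          _ ≤ ∑ b ∈ Icc (-(⌊2 * R * Real.sqrt Z⌋₊ : ℤ)) ⌊2 * R * Real.sqrt Z⌋₊,
                2 * (1 + 2 * R) * (|(b : ℝ)| + 1)⁻¹ :=
              sum_ite_abs_le_le (fun b => by positivity) _ _
          _ = 2 * (1 + 2 * R) * ∑ b ∈ Icc (-(⌊2 * R * Real.sqrt Z⌋₊ : ℤ)) ⌊2 * R * Real.sqrt Z⌋₊,
                (|(b : ℝ)| + 1)⁻¹ := by rw [mul_sum]
          _ ≤ 2 * (1 + 2 * R) * (3 * (1 + Real.log (⌊2 * R * Real.sqrt Z⌋₊ + 1))) := by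
              gcongr
              exact sum_Icc_inv_abs_add_one_le _
    _ = _ := by rw [sum_pair (by norm_num), ← two_mul]

/-! ### The terms with `c ≠ 0`, `b = 0` -/

/-- On the family `((s, 0), (c, s))`, `s = ±1`: `u_R = (cR)²/4`. [folklore] -/
theorem uR_lower (R : ℝ) {s : ℤ} (hs : s = 1 ∨ s = -1) (c : ℤ) :
    uR R ((s, 0), (c, s)) = ((c : ℝ) * R) ^ 2 / 4 := by
  have hs2 : (s : ℝ) ^ 2 = 1 := by
    rcases hs with rfl | rfl <;> norm_num
  unfold uR
  simp only [Int.cast_zero, zero_div]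
  linear_combination hs2 / 2

/-- `∑_{-M ≤ c ≤ M} 1/|c| ≤ 6 (1 + log(M + 1))` (the term `c = 0` is `0`). [folklore] -/
theorem sum_Icc_inv_abs_le (M : ℕ) :
    ∑ c ∈ Icc (-(M : ℤ)) M, (|(c : ℝ)|)⁻¹ ≤ 6 * (1 + Real.log (M + 1)) := by
  have h := sum_Icc_inv_abs_add_one_le M
  have hpt : ∀ c ∈ Icc (-(M : ℤ)) M, (|(c : ℝ)|)⁻¹ ≤ 2 * (|(c : ℝ)| + 1)⁻¹ := by
    intro c _
    rcases eq_or_ne c 0 with rfl | hc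
    · simp
    · have h1 : (1 : ℝ) ≤ |(c : ℝ)| := by exact_mod_cast Int.one_le_abs hc
      rw [← div_eq_mul_inv, le_div_iff₀ (by positivity), inv_mul_eq_div, div_le_iff₀ (by positivity)]
      linarith
  refine (sum_le_sum hpt).trans ?_
  rw [← mul_sum]
  linarith

/-- Pointwise bound for the `b = 0` terms (`c ≠ 0`, `τ(n) ≤ C n^η`):
`k⁺_Z((cR)²/4) · #{q ≤ Q : q ∣ c} ≤ 𝟙{|c| ≤ 2√Z/R} · (2C/R)(2√Z/R)^η / |c|`. [folklore] -/
theorem kPlus_lower_mul_le {R Z : ℝ} (hR : 0 < R) (hZ : 0 ≤ Z) {η C : ℝ} (hη : 0 ≤ η)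
    (hC : ∀ n : ℕ, (#n.divisors : ℝ) ≤ C * (n : ℝ) ^ η) (Q : ℕ) {c : ℤ} (hc : c ≠ 0) :
    kPlus Z (((c : ℝ) * R) ^ 2 / 4) * #((Icc 1 Q).filter (fun q : ℕ => (q : ℤ) ∣ c)) ≤
      if |(c : ℝ)| ≤ 2 * Real.sqrt Z / R then
        (2 * C / R) * (2 * Real.sqrt Z / R) ^ η * (|(c : ℝ)|)⁻¹ else 0 := by
  have hc1 : (1 : ℝ) ≤ |(c : ℝ)| := by exact_mod_cast Int.one_le_abs hc
  have hcpos : 0 < |(c : ℝ)| := by linarith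
  have hC0 : 0 ≤ C := by
    have := hC 1
    simp at this
    linarith
  split_ifs with hcle
  · -- multiplicity
    have hmult : (#((Icc 1 Q).filter (fun q : ℕ => (q : ℤ) ∣ c)) : ℝ) ≤ C * |(c : ℝ)| ^ η := by
      refine (Nat.cast_le.mpr (card_filter_dvd_le Q hc)).trans ?_
      have := hC c.natAbs
      rwa [Nat.cast_natAbs, Int.cast_abs] at this
    have hmult' : (#((Icc 1 Q).filter (fun q : ℕ => (q : ℤ) ∣ c)) : ℝ) ≤
        C * (2 * Real.sqrt Z / R) ^ η :=
      hmult.trans (mul_le_mul_of_nonneg_left (Real.rpow_le_rpow hcpos.le hcle hη) hC0)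
    -- kernel
    have ht : 0 < |(c : ℝ)| * R := by positivity
    have hu : (|(c : ℝ)| * R) ^ 2 / 4 ≤ ((c : ℝ) * R) ^ 2 / 4 := by rw [mul_pow, mul_pow, sq_abs]
    have hk := kPlus_le_two_div (Z := Z) ht hu
    calc kPlus Z (((c : ℝ) * R) ^ 2 / 4) * #((Icc 1 Q).filter (fun q : ℕ => (q : ℤ) ∣ c))
        ≤ (2 / (|(c : ℝ)| * R)) * (C * (2 * Real.sqrt Z / R) ^ η) :=
          mul_le_mul hk hmult' (Nat.cast_nonneg _) (by positivity)
      _ = (2 * C / R) * (2 * Real.sqrt Z / R) ^ η * (|(c : ℝ)|)⁻¹ := by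
          field_simp
  · have h1 : 2 * Real.sqrt Z / R < |(c : ℝ)| := not_le.mp hcle
    rw [kPlus_eq_zero_of_lt, zero_mul]
    rw [div_lt_iff₀ hR] at h1
    have h2 : (2 * Real.sqrt Z) ^ 2 < (|(c : ℝ)| * R) ^ 2 :=
      pow_lt_pow_left₀ h1 (by positivity) two_ne_zero
    rw [mul_pow, Real.sq_sqrt hZ, mul_pow, sq_abs] at h2
    rw [lt_div_iff₀ (by positivity), mul_pow]
    linarith

/-- **The terms with `c ≠ 0`, `b = 0`**: `a = d = ±1`, at most `τ(|c|)` levels divide `c`,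
`k⁺ ≤ 2/(|c|R)` on `|c| ≤ 2√Z/R`; in all `≤ 2 (2C/R)(2√Z/R)^η · 6(1 + log(⌊2√Z/R⌋ + 1))`.
[cite: GrimmeltMerikoski2025, §4.2.1 (the part K_{≠,≠,=}, b' = 0) specialised to β = I] -/
theorem sum_b_eq_zero_le {R Z : ℝ} (hR : 0 < R) (hZ : 0 ≤ Z) {η C : ℝ} (hη : 0 ≤ η)
    (hC : ∀ n : ℕ, (#n.divisors : ℝ) ≤ C * (n : ℝ) ^ η) (Q N : ℕ) :
    ∑ p ∈ (sl2Box N).filter (fun p => p.2.1 ≠ 0 ∧ p.1.2 = 0),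
        kPlus Z (uR R p) * #((Icc 1 Q).filter (fun q : ℕ => (q : ℤ) ∣ p.2.1)) ≤
      2 * ((2 * C / R) * (2 * Real.sqrt Z / R) ^ η *
        (6 * (1 + Real.log (⌊2 * Real.sqrt Z / R⌋₊ + 1)))) := by
  have hC0 : 0 ≤ C := by
    have := hC 1
    simp at this
    linarith
  set T := (sl2Box N).filter (fun p => p.2.1 ≠ 0 ∧ p.1.2 = 0) with hT
  set φ : ℤ × ℤ → (ℤ × ℤ) × (ℤ × ℤ) := fun x => ((x.1, 0), (x.2, x.1)) with hφ
  have hφinj : Function.Injective φ := by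
    intro x y hxy
    simp only [hφ, Prod.mk.injEq] at hxy
    exact Prod.ext hxy.1.1 hxy.2.1
  set D := ({1, -1} : Finset ℤ) ×ˢ (Icc (-(N : ℤ)) N).filter (fun c => c ≠ 0) with hD
  have hsub : T ⊆ D.image φ := by
    intro p hp
    rw [hT, mem_filter, mem_sl2Box] at hp
    obtain ⟨⟨_, ⟨hc, _⟩, hdet⟩, hc0, hb⟩ := hp
    rw [hb, zero_mul, sub_zero] at hdet
    have hcD : p.2.1 ∈ (Icc (-(N : ℤ)) N).filter (fun c => c ≠ 0) :=
      mem_filter.mpr ⟨mem_Icc.mpr hc, hc0⟩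
    rcases Int.eq_one_or_neg_one_of_mul_eq_one' hdet with ⟨ha, hd⟩ | ⟨ha, hd⟩
    · refine mem_image.mpr ⟨(1, p.2.1), ?_, ?_⟩
      · rw [hD, mem_product]; exact ⟨by simp, hcD⟩
      · rw [hφ]; ext <;> simp [ha, hd, hb]
    · refine mem_image.mpr ⟨(-1, p.2.1), ?_, ?_⟩
      · rw [hD, mem_product]; exact ⟨by simp, hcD⟩
      · rw [hφ]; ext <;> simp [ha, hd, hb]
  set g : ℤ → ℝ := fun c => (2 * C / R) * (2 * Real.sqrt Z / R) ^ η * (|(c : ℝ)|)⁻¹ with hg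
  have hg0 : ∀ c, 0 ≤ g c := fun c => by positivity
  have hf0 : ∀ p, 0 ≤ kPlus Z (uR R p) * #((Icc 1 Q).filter (fun q : ℕ => (q : ℤ) ∣ p.2.1)) :=
    fun p => mul_nonneg (kPlus_nonneg _ _) (Nat.cast_nonneg _)
  have hpt : ∀ x ∈ D, kPlus Z (uR R (φ x)) * #((Icc 1 Q).filter (fun q : ℕ => (q : ℤ) ∣ (φ x).2.1)) ≤
      if |(x.2 : ℝ)| ≤ 2 * Real.sqrt Z / R then g x.2 else 0 := by
    intro x hx
    rw [hD, mem_product, mem_filter] at hx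
    have hs : x.1 = 1 ∨ x.1 = -1 := by simpa using hx.1
    have h0 : x.2 ≠ 0 := hx.2.2
    rw [show (φ x).2.1 = x.2 from rfl, show φ x = ((x.1, 0), (x.2, x.1)) from rfl, uR_lower R hs]
    exact kPlus_lower_mul_le hR hZ hη hC Q h0
  set M : ℕ := ⌊2 * Real.sqrt Z / R⌋₊ with hM
  calc ∑ p ∈ T, kPlus Z (uR R p) * #((Icc 1 Q).filter (fun q : ℕ => (q : ℤ) ∣ p.2.1))
      ≤ ∑ p ∈ D.image φ, kPlus Z (uR R p) * #((Icc 1 Q).filter (fun q : ℕ => (q : ℤ) ∣ p.2.1)) :=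
        sum_le_sum_of_subset_of_nonneg hsub fun p _ _ => hf0 p
    _ = ∑ x ∈ D, kPlus Z (uR R (φ x)) * #((Icc 1 Q).filter (fun q : ℕ => (q : ℤ) ∣ (φ x).2.1)) := by
        rw [sum_image fun x _ y _ h => hφinj h]
    _ ≤ ∑ x ∈ D, (if |(x.2 : ℝ)| ≤ 2 * Real.sqrt Z / R then g x.2 else 0) := sum_le_sum hpt
    _ = ∑ s ∈ ({1, -1} : Finset ℤ), ∑ c ∈ (Icc (-(N : ℤ)) N).filter (fun c => c ≠ 0),
          (if |(c : ℝ)| ≤ 2 * Real.sqrt Z / R then g c else 0) := by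
        rw [hD, sum_product]
    _ ≤ ∑ s ∈ ({1, -1} : Finset ℤ), ∑ c ∈ Icc (-(M : ℤ)) M, g c :=
        sum_le_sum fun s _ => sum_ite_abs_le_le hg0 _ _
    _ = 2 * ((2 * C / R) * (2 * Real.sqrt Z / R) ^ η * ∑ c ∈ Icc (-(M : ℤ)) M, (|(c : ℝ)|)⁻¹) := by
        rw [sum_pair (by norm_num), ← two_mul, hg, mul_sum, mul_sum, mul_sum]
    _ ≤ 2 * ((2 * C / R) * (2 * Real.sqrt Z / R) ^ η * (6 * (1 + Real.log (M + 1)))) := by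
        gcongr
        exact sum_Icc_inv_abs_le M

/-! ### The terms with `b ≠ 0`, `c ≠ 0` -/

/-- The non-zero integers `b` of a finite set dividing `n ≠ 0` number at most `2τ(|n|)`. [folklore] -/
theorem card_filter_dvd_ne_zero_le {n : ℤ} (hn : n ≠ 0) (S : Finset ℤ) :
    #(S.filter (fun b => b ∣ n ∧ b ≠ 0)) ≤ 2 * #(n.natAbs.divisors) := by
  have hsub : S.filter (fun b => b ∣ n ∧ b ≠ 0) ⊆
      (n.natAbs.divisors.image (fun m : ℕ => (m : ℤ))) ∪
        (n.natAbs.divisors.image (fun m : ℕ => -(m : ℤ))) := by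
    intro b hb
    rw [mem_filter] at hb
    have hmem : b.natAbs ∈ n.natAbs.divisors :=
      Nat.mem_divisors.mpr ⟨Int.natAbs_dvd_natAbs.mpr hb.2.1, Int.natAbs_ne_zero.mpr hn⟩
    rw [mem_union, mem_image, mem_image]
    rcases Int.natAbs_eq b with h | h
    · exact Or.inl ⟨b.natAbs, hmem, h.symm⟩
    · exact Or.inr ⟨b.natAbs, hmem, h.symm⟩
  refine (card_le_card hsub).trans ((card_union_le _ _).trans ?_)
  rw [two_mul]
  exact add_le_add card_image_le card_image_le

/-- The weight is controlled by the diagonal entries: `1/√(1 + u_R(γ)) ≤ 4/(|a| + |d| + 1)`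
(`4(1 + u_R) ≥ a² + d² + 2 ≥ (|a| + |d| + 1)²/4`). [folklore] -/
theorem inv_sqrt_one_add_uR_le {R : ℝ} (p : (ℤ × ℤ) × (ℤ × ℤ)) :
    (Real.sqrt (1 + uR R p))⁻¹ ≤ 4 / (|(p.1.1 : ℝ)| + |(p.2.2 : ℝ)| + 1) := by
  set A : ℝ := |(p.1.1 : ℝ)| + |(p.2.2 : ℝ)| + 1 with hA
  have hA0 : 0 < A := by positivity
  have hsq : (A / 4) ^ 2 ≤ 1 + uR R p := by
    have h1 : A ^ 2 ≤ 4 * ((p.1.1 : ℝ) ^ 2 + (p.2.2 : ℝ) ^ 2 + 2) := by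
      rw [hA]
      nlinarith [sq_nonneg (|(p.1.1 : ℝ)| - |(p.2.2 : ℝ)|), sq_nonneg (|(p.1.1 : ℝ)| - 1),
        sq_nonneg (|(p.2.2 : ℝ)| - 1), sq_abs (p.1.1 : ℝ), sq_abs (p.2.2 : ℝ),
        abs_nonneg (p.1.1 : ℝ), abs_nonneg (p.2.2 : ℝ)]
    have h2 : (p.1.1 : ℝ) ^ 2 + (p.2.2 : ℝ) ^ 2 + 2 ≤ 4 * (1 + uR R p) := by
      unfold uR
      nlinarith [sq_nonneg ((p.1.2 : ℝ) / R), sq_nonneg ((p.2.1 : ℝ) * R)]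
    nlinarith
  have hle : A / 4 ≤ Real.sqrt (1 + uR R p) := Real.le_sqrt_of_sq_le hsq
  rw [inv_le_comm₀ (lt_of_lt_of_le (by positivity) hle) (by positivity), inv_div]
  exact hle

/-- On the support `u_R(γ) ≤ Z`: `a² ≤ 4Z + 2`, `d² ≤ 4Z + 2` and `|ad - 1| ≤ 4Z + 3`. [folklore] -/
theorem sq_le_of_uR_le {R Z : ℝ} {p : (ℤ × ℤ) × (ℤ × ℤ)} (hu : uR R p ≤ Z) :
    (p.1.1 : ℝ) ^ 2 ≤ 4 * Z + 2 ∧ (p.2.2 : ℝ) ^ 2 ≤ 4 * Z + 2 ∧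
      |(p.1.1 : ℝ) * p.2.2 - 1| ≤ 4 * Z + 3 := by
  unfold uR at hu
  have hb := sq_nonneg ((p.1.2 : ℝ) / R)
  have hc := sq_nonneg ((p.2.1 : ℝ) * R)
  refine ⟨by nlinarith, by nlinarith, abs_le.mpr ⟨?_, ?_⟩⟩
  · nlinarith [sq_nonneg ((p.1.1 : ℝ) + p.2.2)]
  · nlinarith [sq_nonneg ((p.1.1 : ℝ) - p.2.2)]

/-- **The terms with `b ≠ 0`, `c ≠ 0`** (`τ(n) ≤ C n^η`): here `bc = ad - 1 ≠ 0`, at most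
`τ(|c|) ≤ C(4Z+3)^η` levels divide `c`, the weight is `≤ 4/(|a| + |d| + 1)`, and for fixed
`(a, d)` there are at most `2τ(|ad - 1|) ≤ 2C(4Z+3)^η` pairs `(b, c)`; in all
`≤ 2C(4Z+3)^η · (2A₀ + 1) · (4C(4Z+3)^η · 3(1 + log(A₀ + 1)))`, `A₀ = ⌊√(4Z+2)⌋`.
[cite: GrimmeltMerikoski2025, §4.2.1 (the off-diagonal part K_{≠,≠,≠}) specialised to β = I] -/
theorem sum_bc_ne_zero_le {R Z : ℝ} (hZ : 0 ≤ Z) {η C : ℝ} (hη : 0 ≤ η)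
    (hC : ∀ n : ℕ, (#n.divisors : ℝ) ≤ C * (n : ℝ) ^ η) (Q N : ℕ) :
    ∑ p ∈ (sl2Box N).filter (fun p => p.2.1 ≠ 0 ∧ p.1.2 ≠ 0),
        kPlus Z (uR R p) * #((Icc 1 Q).filter (fun q : ℕ => (q : ℤ) ∣ p.2.1)) ≤
      2 * C * (4 * Z + 3) ^ η * ((2 * (⌊Real.sqrt (4 * Z + 2)⌋₊ : ℝ) + 1) *
        (4 * C * (4 * Z + 3) ^ η * (3 * (1 + Real.log (⌊Real.sqrt (4 * Z + 2)⌋₊ + 1))))) := by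
  have hC0 : 0 ≤ C := by
    have := hC 1
    simp at this
    linarith
  set T := (sl2Box N).filter (fun p => p.2.1 ≠ 0 ∧ p.1.2 ≠ 0) with hT
  set B : ℝ := Real.sqrt (4 * Z + 2) with hB
  set K : ℝ := 4 * C * (4 * Z + 3) ^ η with hK
  have hK0 : 0 ≤ K := by positivity
  set G : ℤ × ℤ → ℝ := fun y =>
    if |(y.1 : ℝ)| ≤ B ∧ |(y.2 : ℝ)| ≤ B then K / (|(y.1 : ℝ)| + |(y.2 : ℝ)| + 1) else 0 with hG
  have hG0 : ∀ y, 0 ≤ G y := fun y => by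
    simp only [hG]
    split_ifs
    · positivity
    · exact le_rfl
  set pr : (ℤ × ℤ) × (ℤ × ℤ) → ℤ × ℤ := fun p => (p.1.1, p.2.2) with hpr
  -- Step 1: pointwise bound by `G (a, d)`
  have hpt : ∀ p ∈ T, kPlus Z (uR R p) * #((Icc 1 Q).filter (fun q : ℕ => (q : ℤ) ∣ p.2.1)) ≤
      G (pr p) := by
    intro p hp
    rw [hT, mem_filter] at hp
    obtain ⟨hpbox, hc0, hb0⟩ := hp
    rcases lt_or_ge Z (uR R p) with hu | hu
    · rw [kPlus_eq_zero_of_lt hu, zero_mul]; exact hG0 _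
    obtain ⟨ha2, hd2, had⟩ := sq_le_of_uR_le hu
    have haB : |(p.1.1 : ℝ)| ≤ B := Real.abs_le_sqrt ha2
    have hdB : |(p.2.2 : ℝ)| ≤ B := Real.abs_le_sqrt hd2
    have hGp : G (pr p) = K / (|(p.1.1 : ℝ)| + |(p.2.2 : ℝ)| + 1) := by
      simp only [hG, hpr]
      rw [if_pos ⟨haB, hdB⟩]
    rw [hGp]
    -- multiplicity
    have hdet := (mem_sl2Box.mp hpbox).2.2
    have hcle : |(p.2.1 : ℝ)| ≤ 4 * Z + 3 := by
      have h1 : |(p.2.1 : ℝ)| ≤ |(p.1.2 : ℝ)| * |(p.2.1 : ℝ)| := by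
        have : (1 : ℝ) ≤ |(p.1.2 : ℝ)| := by exact_mod_cast Int.one_le_abs hb0
        nlinarith [abs_nonneg (p.2.1 : ℝ)]
      have h2 : |(p.1.2 : ℝ)| * |(p.2.1 : ℝ)| = |(p.1.1 : ℝ) * p.2.2 - 1| := by
        rw [← abs_mul]
        congr 1
        have : (p.1.1 : ℝ) * p.2.2 - p.1.2 * p.2.1 = 1 := by exact_mod_cast hdet
        linarith
      linarith
    have hmult : (#((Icc 1 Q).filter (fun q : ℕ => (q : ℤ) ∣ p.2.1)) : ℝ) ≤ C * (4 * Z + 3) ^ η := by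
      refine (Nat.cast_le.mpr (card_filter_dvd_le Q hc0)).trans ?_
      have h1 := hC p.2.1.natAbs
      rw [Nat.cast_natAbs, Int.cast_abs] at h1
      exact h1.trans (mul_le_mul_of_nonneg_left
        (Real.rpow_le_rpow (abs_nonneg _) hcle hη) hC0)
    have hw : kPlus Z (uR R p) ≤ 4 / (|(p.1.1 : ℝ)| + |(p.2.2 : ℝ)| + 1) :=
      kPlus_le_inv_sqrt.trans (inv_sqrt_one_add_uR_le p)
    calc kPlus Z (uR R p) * #((Icc 1 Q).filter (fun q : ℕ => (q : ℤ) ∣ p.2.1))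
        ≤ 4 / (|(p.1.1 : ℝ)| + |(p.2.2 : ℝ)| + 1) * (C * (4 * Z + 3) ^ η) :=
          mul_le_mul hw hmult (Nat.cast_nonneg _) (by positivity)
      _ = K / (|(p.1.1 : ℝ)| + |(p.2.2 : ℝ)| + 1) := by rw [hK]; ring
  -- Step 2: the fibres of `pr` on `T` have at most `2C(4Z+3)^η` elements where `G ≠ 0`
  have hfib : ∀ y : ℤ × ℤ, (#(T.filter (fun p => pr p = y)) : ℝ) * G y ≤
      2 * C * (4 * Z + 3) ^ η * G y := by
    rintro ⟨y1, y2⟩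
    by_cases hy : |(y1 : ℝ)| ≤ B ∧ |(y2 : ℝ)| ≤ B
    swap
    · have : G (y1, y2) = 0 := by simp only [hG]; rw [if_neg hy]
      rw [this, mul_zero, mul_zero]
    refine mul_le_mul_of_nonneg_right ?_ (hG0 (y1, y2))
    set n : ℤ := y1 * y2 - 1 with hn
    rcases eq_or_ne n 0 with hn0 | hn0
    · -- empty fibre
      have : T.filter (fun p => pr p = (y1, y2)) = ∅ := by
        refine filter_eq_empty_iff.mpr fun p hp hpy => ?_
        rw [hT, mem_filter] at hp
        obtain ⟨hpbox, hc0, hb0⟩ := hp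
        have hdet := (mem_sl2Box.mp hpbox).2.2
        simp only [hpr, Prod.mk.injEq] at hpy
        have : p.1.2 * p.2.1 = 0 := by rw [hpy.1, hpy.2] at hdet; linarith
        rcases mul_eq_zero.mp this with h | h
        · exact hb0 h
        · exact hc0 h
      rw [this, card_empty, Nat.cast_zero]
      positivity
    · have hmaps : ∀ p ∈ T.filter (fun p => pr p = (y1, y2)),
          p.1.2 ∈ (Icc (-(N : ℤ)) N).filter (fun b => b ∣ n ∧ b ≠ 0) := by
        intro p hp
        rw [mem_filter, hT, mem_filter] at hp
        obtain ⟨⟨hpbox, hc0, hb0⟩, hpy⟩ := hp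
        have hbox := mem_sl2Box.mp hpbox
        simp only [hpr, Prod.mk.injEq] at hpy
        refine mem_filter.mpr ⟨mem_Icc.mpr hbox.1.2, ⟨p.2.1, ?_⟩, hb0⟩
        rw [hn, ← hpy.1, ← hpy.2]
        linarith [hbox.2.2]
      have hinj : Set.InjOn (fun p : (ℤ × ℤ) × (ℤ × ℤ) => p.1.2) ↑(T.filter (fun p => pr p = (y1, y2))) := by
        intro p hp p' hp' hbb
        rw [coe_filter, Set.mem_setOf_eq, hT, mem_filter] at hp hp'
        obtain ⟨⟨hpbox, hc0, hb0⟩, hpy⟩ := hp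
        obtain ⟨⟨hpbox', hc0', hb0'⟩, hpy'⟩ := hp'
        have hdet := (mem_sl2Box.mp hpbox).2.2
        have hdet' := (mem_sl2Box.mp hpbox').2.2
        simp only [hpr, Prod.mk.injEq] at hpy hpy'
        have ha : p.1.1 = p'.1.1 := by rw [hpy.1, hpy'.1]
        have hd : p.2.2 = p'.2.2 := by rw [hpy.2, hpy'.2]
        have hb : p.1.2 = p'.1.2 := hbb
        have hc : p.2.1 = p'.2.1 := by
          have h1 : p.1.2 * p.2.1 = p.1.2 * p'.2.1 := by
            rw [ha, hd] at hdet
            nth_rewrite 2 [hb]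
            linarith
          exact mul_left_cancel₀ hb0 h1
        exact Prod.ext (Prod.ext ha hb) (Prod.ext hc hd)
      have hcard := card_le_card_of_injOn _ hmaps hinj
      have hnle : |(n : ℝ)| ≤ 4 * Z + 3 := by
        have h1 : (y1 : ℝ) ^ 2 ≤ 4 * Z + 2 := by
          have := hy.1
          rw [hB] at this
          have h0 : 0 ≤ 4 * Z + 2 := by positivity
          nlinarith [Real.sq_sqrt h0, abs_nonneg (y1 : ℝ), sq_abs (y1 : ℝ),
            Real.sqrt_nonneg (4 * Z + 2)]
        have h2 : (y2 : ℝ) ^ 2 ≤ 4 * Z + 2 := by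
          have := hy.2
          rw [hB] at this
          have h0 : 0 ≤ 4 * Z + 2 := by positivity
          nlinarith [Real.sq_sqrt h0, abs_nonneg (y2 : ℝ), sq_abs (y2 : ℝ),
            Real.sqrt_nonneg (4 * Z + 2)]
        rw [hn]
        push_cast
        refine abs_le.mpr ⟨?_, ?_⟩
        · nlinarith [sq_nonneg ((y1 : ℝ) + y2)]
        · nlinarith [sq_nonneg ((y1 : ℝ) - y2)]
      calc (#(T.filter (fun p => pr p = (y1, y2))) : ℝ)
          ≤ #((Icc (-(N : ℤ)) N).filter (fun b => b ∣ n ∧ b ≠ 0)) := by exact_mod_cast hcard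
        _ ≤ 2 * #(n.natAbs.divisors) := by exact_mod_cast card_filter_dvd_ne_zero_le hn0 _
        _ ≤ 2 * (C * |(n : ℝ)| ^ η) := by
            have h1 := hC n.natAbs
            rw [Nat.cast_natAbs, Int.cast_abs] at h1
            linarith
        _ ≤ 2 * (C * (4 * Z + 3) ^ η) := by
            gcongr
        _ = 2 * C * (4 * Z + 3) ^ η := by ring
  -- Step 3: assemble
  set A₀ : ℕ := ⌊B⌋₊ with hA₀
  calc ∑ p ∈ T, kPlus Z (uR R p) * #((Icc 1 Q).filter (fun q : ℕ => (q : ℤ) ∣ p.2.1))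
      ≤ ∑ p ∈ T, G (pr p) := sum_le_sum hpt
    _ = ∑ y ∈ T.image pr, (#(T.filter (fun p => pr p = y)) : ℝ) * G y := by
        rw [sum_comp]
        refine sum_congr rfl fun y _ => ?_
        rw [nsmul_eq_mul]
    _ ≤ ∑ y ∈ T.image pr, 2 * C * (4 * Z + 3) ^ η * G y := sum_le_sum fun y _ => hfib y
    _ = 2 * C * (4 * Z + 3) ^ η * ∑ y ∈ T.image pr, G y := by rw [mul_sum]
    _ ≤ 2 * C * (4 * Z + 3) ^ η * ∑ y ∈ (Icc (-(N : ℤ)) N) ×ˢ (Icc (-(N : ℤ)) N), G y := by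
        have hsubImg : T.image pr ⊆ (Icc (-(N : ℤ)) N) ×ˢ (Icc (-(N : ℤ)) N) := by
          intro y hy
          rw [mem_image] at hy
          obtain ⟨p, hp, rfl⟩ := hy
          rw [hT, mem_filter] at hp
          have hbox := mem_sl2Box.mp hp.1
          exact mem_product.mpr ⟨mem_Icc.mpr hbox.1.1, mem_Icc.mpr hbox.2.1.2⟩
        exact mul_le_mul_of_nonneg_left
          (sum_le_sum_of_subset_of_nonneg hsubImg fun y _ _ => hG0 y) (by positivity)
    _ = 2 * C * (4 * Z + 3) ^ η * ∑ a ∈ Icc (-(N : ℤ)) N, ∑ d ∈ Icc (-(N : ℤ)) N, G (a, d) := by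
        rw [sum_product]
    _ ≤ 2 * C * (4 * Z + 3) ^ η * ∑ a ∈ Icc (-(N : ℤ)) N,
          (if |(a : ℝ)| ≤ B then K * (3 * (1 + Real.log (A₀ + 1))) else 0) := by
        gcongr with a ha
        split_ifs with haB
        · calc ∑ d ∈ Icc (-(N : ℤ)) N, G (a, d)
              ≤ ∑ d ∈ Icc (-(N : ℤ)) N, (if |(d : ℝ)| ≤ B then K * (|(d : ℝ)| + 1)⁻¹ else 0) := by
                refine sum_le_sum fun d _ => ?_
                simp only [hG]
                split_ifs with h1 h2 h2
                · rw [div_eq_mul_inv]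
                  gcongr
                  linarith [abs_nonneg (a : ℝ)]
                · exact absurd h1.2 h2
                · positivity
                · exact le_rfl
            _ ≤ ∑ d ∈ Icc (-(A₀ : ℤ)) A₀, K * (|(d : ℝ)| + 1)⁻¹ :=
                sum_ite_abs_le_le (fun d => by positivity) B _
            _ = K * ∑ d ∈ Icc (-(A₀ : ℤ)) A₀, (|(d : ℝ)| + 1)⁻¹ := by rw [mul_sum]
            _ ≤ K * (3 * (1 + Real.log (A₀ + 1))) :=
                mul_le_mul_of_nonneg_left (sum_Icc_inv_abs_add_one_le A₀) hK0
        · refine (sum_eq_zero fun d _ => ?_).le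
          simp only [hG]
          rw [if_neg (fun h => haB h.1)]
    _ ≤ 2 * C * (4 * Z + 3) ^ η * ∑ a ∈ Icc (-(A₀ : ℤ)) A₀, K * (3 * (1 + Real.log (A₀ + 1))) := by
        gcongr
        refine sum_ite_abs_le_le (fun a => ?_) B _
        have : 0 ≤ Real.log (A₀ + 1) := Real.log_nonneg (by linarith [(Nat.cast_nonneg A₀ : (0:ℝ) ≤ A₀)])
        positivity
    _ = 2 * C * (4 * Z + 3) ^ η * ((2 * (A₀ : ℝ) + 1) * (K * (3 * (1 + Real.log (A₀ + 1))))) := by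
        rw [sum_const, nsmul_eq_mul, Int.card_Icc]
        congr 2
        rw [show (A₀ : ℤ) + 1 - -(A₀ : ℤ) = ((2 * A₀ + 1 : ℕ) : ℤ) by push_cast; ring, Int.toNat_natCast]
        push_cast
        ring

/-! ### Assembly: Proposition 4.2 in the Type I case -/

/-- Elementary size facts for `L = (2 + Z)(2 + R + R⁻¹)`, `Z ≥ 1`, `R > 0`. [folklore] -/
theorem aux_L_bounds {R Z : ℝ} (hR : 0 < R) (hZ : 1 ≤ Z) :
    12 ≤ (2 + Z) * (2 + R + R⁻¹) ∧
    2 * R * Real.sqrt Z + 1 ≤ (2 + Z) * (2 + R + R⁻¹) ∧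
    2 * Real.sqrt Z / R + 1 ≤ (2 + Z) * (2 + R + R⁻¹) ∧
    4 * Z + 3 ≤ (2 + Z) * (2 + R + R⁻¹) ∧
    Real.sqrt (4 * Z + 2) + 1 ≤ (2 + Z) * (2 + R + R⁻¹) ∧
    2 * Real.sqrt (4 * Z + 2) + 1 ≤ 6 * Real.sqrt Z := by
  set s := Real.sqrt Z with hs
  set t := Real.sqrt (4 * Z + 2) with ht
  have hs1 : 1 ≤ s := Real.one_le_sqrt.mpr hZ
  have hs2 : s ^ 2 = Z := Real.sq_sqrt (by linarith)
  have ht0 : 0 ≤ t := Real.sqrt_nonneg _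
  have ht2 : t ^ 2 = 4 * Z + 2 := Real.sq_sqrt (by linarith)
  have ht1 : 1 ≤ t := by nlinarith
  have hRi : 0 < R⁻¹ := inv_pos.mpr hR
  have hRR : 2 ≤ R + R⁻¹ := by
    have h1 : R + R⁻¹ - 2 = (R - 1) ^ 2 / R := by field_simp; ring
    have h2 : 0 ≤ (R - 1) ^ 2 / R := by positivity
    linarith
  have h2s : 2 * s ≤ 1 + Z := by nlinarith [sq_nonneg (s - 1)]
  have hL : (2 + Z) * (2 + R + R⁻¹) = 2 * (2 + Z) + R * (2 + Z) + R⁻¹ * (2 + Z) := by ring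
  refine ⟨by nlinarith, ?_, ?_, by nlinarith, by nlinarith, ?_⟩
  · rw [hL]
    have : 2 * R * s ≤ R * (2 + Z) := by nlinarith
    nlinarith [mul_pos hRi (by linarith : (0:ℝ) < 2 + Z)]
  · rw [hL, div_eq_mul_inv, mul_comm (2 * s) R⁻¹]
    have : R⁻¹ * (2 * s) ≤ R⁻¹ * (2 + Z) := mul_le_mul_of_nonneg_left (by linarith) hRi.le
    nlinarith [mul_pos hR (by linarith : (0:ℝ) < 2 + Z)]
  · nlinarith

/-- **Proposition 4.2 of [GrimmeltMerikoski2025] in the Type I case** (`β = I`, i.e.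
`D = N₀ = N₂ = T = V = 1` in the notation of the proposition; the paper's simplified form
`V²(R⁻¹ + Z^{1/2}) + (1 + R)(V²N + VN²)` with `V = 1`, `N = Q`): for every `ε > 0` there is `C`
such that for all `Q`, `R > 0`, `Z ≥ 1` (and every box size `N`),
`∑_{q ≤ Q} ∑_{γ ∈ Γ₀(q)} 𝟙{u_R(γ) ≤ Z}/√(1 + u_R(γ)) ≤ C ((2+Z)(2+R+R⁻¹))^ε (Q(1 + R) + R⁻¹ + Z^{1/2})`
— the bound `K₁ ≺≺ D(1 + 𝐗) + 𝐗⁻¹ + Z₁` of [GrimmeltMerikoski2025, §5 (eq. K1bound)] with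
`Q = aD`, `R = 𝐗`, `Z = Z₁²`.  Proof as in §4.2 of the paper specialised to `v = v' = 0`:
interchange `q` and `γ` (`sum_Icc_kernelDiagSum_eq`); `c = 0` forces `a = d = ±1` and costs
`Q ∑_b k⁺((b/R)²/4) ≪ Q(1 + R) log` (`sum_c_eq_zero_le`); `c ≠ 0 = b` costs
`∑_c τ(|c|) 2/(|c|R) ≪ R⁻¹ Z^{o(1)}` (`sum_b_eq_zero_le`); `bc ≠ 0` is absorbed by the divisor
bound into `∑_{a,d} (|a|+|d|+1)⁻¹ ≪ Z^{1/2+o(1)}` (`sum_bc_ne_zero_le`).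
[cite: GrimmeltMerikoski2025, Proposition 4.2 and §5 (K₁ ≺≺ D(1+𝐗)+𝐗⁻¹+Z₁)] -/
theorem exists_sum_kernelDiagSum_le {ε : ℝ} (hε : 0 < ε) :
    ∃ C : ℝ, 0 < C ∧ ∀ (Q N : ℕ) (R Z : ℝ), 0 < R → 1 ≤ Z →
      ∑ q ∈ Icc 1 Q, kernelDiagSum q R Z N ≤
        C * ((2 + Z) * (2 + R + R⁻¹)) ^ ε * (Q * (1 + R) + R⁻¹ + Real.sqrt Z) := by
  -- the divisor-bound exponent
  set η : ℝ := min ε 1 / 4 with hη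
  have hmin : 0 < min ε 1 := lt_min hε one_pos
  have hη0 : 0 < η := by positivity
  have h3η : 3 * η ≤ ε := by
    have : min ε 1 ≤ ε := min_le_left _ _
    rw [hη]; linarith
  obtain ⟨Cτ, hCτ1, hCτ⟩ := exists_card_divisors_le_mul_rpow' hη0
  have hCτ0 : 0 ≤ Cτ := by linarith
  set c₁ : ℝ := 1 + 1 / η with hc₁
  have hc₁1 : 1 ≤ c₁ := by rw [hc₁]; have := one_div_pos.mpr hη0; linarith
  refine ⟨144 * Cτ ^ 2 * c₁, by positivity, fun Q N R Z hR hZ => ?_⟩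
  have hZ0 : 0 ≤ Z := by linarith
  obtain ⟨hL12, hL1, hL2, hL3, hL4, hA6⟩ := aux_L_bounds hR hZ
  set L : ℝ := (2 + Z) * (2 + R + R⁻¹) with hLdef
  have hL1' : 1 ≤ L := by linarith
  have hLη : 1 ≤ L ^ η := Real.one_le_rpow hL1' hη0.le
  -- `1 + log L ≤ (1 + 1/η) L^η` (as in `Iwaniec1978.one_add_log_le`)
  have hlogL : 1 + Real.log L ≤ c₁ * L ^ η := by
    have h1 : Real.log L ≤ L ^ η / η := Real.log_le_rpow_div (by linarith) hη0
    rw [hc₁, add_mul, one_mul, one_div, inv_mul_eq_div]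
    linarith
  -- log factors
  have hlog1 : 1 + Real.log (⌊2 * R * Real.sqrt Z⌋₊ + 1) ≤ c₁ * L ^ η := by
    refine le_trans ?_ hlogL
    have h0 : (0 : ℝ) < ⌊2 * R * Real.sqrt Z⌋₊ + 1 := by positivity
    have h1 : (⌊2 * R * Real.sqrt Z⌋₊ : ℝ) + 1 ≤ L := by
      have := Nat.floor_le (by positivity : (0 : ℝ) ≤ 2 * R * Real.sqrt Z)
      linarith
    linarith [Real.log_le_log h0 h1]
  have hlog2 : 1 + Real.log (⌊2 * Real.sqrt Z / R⌋₊ + 1) ≤ c₁ * L ^ η := by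
    refine le_trans ?_ hlogL
    have h0 : (0 : ℝ) < ⌊2 * Real.sqrt Z / R⌋₊ + 1 := by positivity
    have h1 : (⌊2 * Real.sqrt Z / R⌋₊ : ℝ) + 1 ≤ L := by
      have := Nat.floor_le (by positivity : (0 : ℝ) ≤ 2 * Real.sqrt Z / R)
      linarith
    linarith [Real.log_le_log h0 h1]
  have hlog3 : 1 + Real.log (⌊Real.sqrt (4 * Z + 2)⌋₊ + 1) ≤ c₁ * L ^ η := by
    refine le_trans ?_ hlogL
    have h0 : (0 : ℝ) < ⌊Real.sqrt (4 * Z + 2)⌋₊ + 1 := by positivity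
    have h1 : (⌊Real.sqrt (4 * Z + 2)⌋₊ : ℝ) + 1 ≤ L := by
      have := Nat.floor_le (Real.sqrt_nonneg (4 * Z + 2))
      linarith
    linarith [Real.log_le_log h0 h1]
  -- power factors
  have hpow2 : (2 * Real.sqrt Z / R) ^ η ≤ L ^ η :=
    Real.rpow_le_rpow (by positivity) (by linarith) hη0.le
  have hpow3 : (4 * Z + 3) ^ η ≤ L ^ η := Real.rpow_le_rpow (by positivity) hL3 hη0.le
  have hA : 2 * (⌊Real.sqrt (4 * Z + 2)⌋₊ : ℝ) + 1 ≤ 6 * Real.sqrt Z := by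
    have := Nat.floor_le (Real.sqrt_nonneg (4 * Z + 2))
    linarith
  -- the three pieces
  have hf0 : ∀ p, 0 ≤ kPlus Z (uR R p) * #((Icc 1 Q).filter (fun q : ℕ => (q : ℤ) ∣ p.2.1)) :=
    fun p => mul_nonneg (kPlus_nonneg _ _) (Nat.cast_nonneg _)
  have h1 := sum_c_eq_zero_le hR hZ0 Q N
  have h2 := sum_b_eq_zero_le hR hZ0 hη0.le hCτ Q N
  have h3 := sum_bc_ne_zero_le (R := R) hZ0 hη0.le hCτ Q N
  have hsplit1 : ∑ p ∈ sl2Box N, kPlus Z (uR R p) * #((Icc 1 Q).filter (fun q : ℕ => (q : ℤ) ∣ p.2.1)) =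
      ∑ p ∈ (sl2Box N).filter (fun p => p.2.1 = 0),
          kPlus Z (uR R p) * #((Icc 1 Q).filter (fun q : ℕ => (q : ℤ) ∣ p.2.1)) +
        ∑ p ∈ (sl2Box N).filter (fun p => p.2.1 ≠ 0),
          kPlus Z (uR R p) * #((Icc 1 Q).filter (fun q : ℕ => (q : ℤ) ∣ p.2.1)) :=
    (sum_filter_add_sum_filter_not _ _ _).symm
  have hsplit2 : ∑ p ∈ (sl2Box N).filter (fun p => p.2.1 ≠ 0),
        kPlus Z (uR R p) * #((Icc 1 Q).filter (fun q : ℕ => (q : ℤ) ∣ p.2.1)) =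
      ∑ p ∈ (sl2Box N).filter (fun p => p.2.1 ≠ 0 ∧ p.1.2 = 0),
          kPlus Z (uR R p) * #((Icc 1 Q).filter (fun q : ℕ => (q : ℤ) ∣ p.2.1)) +
        ∑ p ∈ (sl2Box N).filter (fun p => p.2.1 ≠ 0 ∧ p.1.2 ≠ 0),
          kPlus Z (uR R p) * #((Icc 1 Q).filter (fun q : ℕ => (q : ℤ) ∣ p.2.1)) := by
    rw [← sum_filter_add_sum_filter_not ((sl2Box N).filter (fun p => p.2.1 ≠ 0))
      (fun p => p.1.2 = 0), filter_filter, filter_filter]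
  rw [sum_Icc_kernelDiagSum_eq, hsplit1, hsplit2]
  -- bound each piece by a multiple of `L^{3η}`
  have hL3η : L ^ η ≤ L ^ (3 * η) := Real.rpow_le_rpow_of_exponent_le hL1' (by linarith)
  have hL3η' : L ^ η * L ^ η * L ^ η = L ^ (3 * η) := by
    rw [← Real.rpow_add (by linarith), ← Real.rpow_add (by linarith)]; ring_nf
  have hLε : L ^ (3 * η) ≤ L ^ ε := Real.rpow_le_rpow_of_exponent_le hL1' h3η
  have hLη0 : 0 ≤ L ^ η := by positivity
  have hsZ : 1 ≤ Real.sqrt Z := Real.one_le_sqrt.mpr hZ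
  -- piece 1 ≤ 24 c₁ Q (1+R) L^η
  have hb1 : (Q : ℝ) * (2 * (2 * (1 + 2 * R) * (3 * (1 + Real.log (⌊2 * R * Real.sqrt Z⌋₊ + 1))))) ≤
      24 * c₁ * (Q * (1 + R)) * L ^ (3 * η) := by
    have hQ : (0 : ℝ) ≤ Q := Nat.cast_nonneg Q
    have hkey : (1 + 2 * R) * (1 + Real.log (⌊2 * R * Real.sqrt Z⌋₊ + 1)) ≤
        2 * (1 + R) * (c₁ * L ^ (3 * η)) := by
      have hlog0 : 0 ≤ 1 + Real.log (⌊2 * R * Real.sqrt Z⌋₊ + 1) := by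
        have : (0:ℝ) ≤ Real.log (⌊2 * R * Real.sqrt Z⌋₊ + 1) :=
          Real.log_nonneg (by linarith [(Nat.cast_nonneg _ : (0:ℝ) ≤ ⌊2 * R * Real.sqrt Z⌋₊)])
        linarith
      refine mul_le_mul (by linarith) (hlog1.trans ?_) hlog0 (by positivity)
      exact mul_le_mul_of_nonneg_left hL3η (by linarith)
    calc (Q : ℝ) * (2 * (2 * (1 + 2 * R) * (3 * (1 + Real.log (⌊2 * R * Real.sqrt Z⌋₊ + 1)))))
        = 12 * Q * ((1 + 2 * R) * (1 + Real.log (⌊2 * R * Real.sqrt Z⌋₊ + 1))) := by ring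
      _ ≤ 12 * Q * (2 * (1 + R) * (c₁ * L ^ (3 * η))) :=
          mul_le_mul_of_nonneg_left hkey (by positivity)
      _ = 24 * c₁ * (Q * (1 + R)) * L ^ (3 * η) := by ring
  -- piece 2 ≤ 24 Cτ c₁ R⁻¹ L^{3η}
  have hb2 : 2 * ((2 * Cτ / R) * (2 * Real.sqrt Z / R) ^ η *
      (6 * (1 + Real.log (⌊2 * Real.sqrt Z / R⌋₊ + 1)))) ≤ 24 * Cτ * c₁ * R⁻¹ * L ^ (3 * η) := by
    have e1 : 2 * Cτ / R = 2 * Cτ * R⁻¹ := by rw [div_eq_mul_inv]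
    rw [e1]
    have hlog0 : 0 ≤ 1 + Real.log (⌊2 * Real.sqrt Z / R⌋₊ + 1) := by
      have : (0:ℝ) ≤ Real.log (⌊2 * Real.sqrt Z / R⌋₊ + 1) := Real.log_nonneg (by linarith [(Nat.cast_nonneg _ : (0:ℝ) ≤ ⌊2 * Real.sqrt Z / R⌋₊)])
      linarith
    have hprod : (2 * Real.sqrt Z / R) ^ η * (1 + Real.log (⌊2 * Real.sqrt Z / R⌋₊ + 1)) ≤
        L ^ η * (c₁ * L ^ η) := mul_le_mul hpow2 hlog2 hlog0 hLη0
    have hLL : L ^ η * (c₁ * L ^ η) ≤ c₁ * L ^ (3 * η) := by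
      rw [← hL3η']
      have h4 : L ^ η * L ^ η ≤ L ^ η * L ^ η * L ^ η := le_mul_of_one_le_right (by positivity) hLη
      calc L ^ η * (c₁ * L ^ η) = c₁ * (L ^ η * L ^ η) := by ring
        _ ≤ c₁ * (L ^ η * L ^ η * L ^ η) := mul_le_mul_of_nonneg_left h4 (by positivity)
    have hRi : 0 ≤ R⁻¹ := by positivity
    calc 2 * ((2 * Cτ * R⁻¹) * (2 * Real.sqrt Z / R) ^ η *
          (6 * (1 + Real.log (⌊2 * Real.sqrt Z / R⌋₊ + 1))))
        = 24 * Cτ * R⁻¹ * ((2 * Real.sqrt Z / R) ^ η *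
            (1 + Real.log (⌊2 * Real.sqrt Z / R⌋₊ + 1))) := by ring
      _ ≤ 24 * Cτ * R⁻¹ * (c₁ * L ^ (3 * η)) :=
          mul_le_mul_of_nonneg_left (hprod.trans hLL) (by positivity)
      _ = 24 * Cτ * c₁ * R⁻¹ * L ^ (3 * η) := by ring
  -- piece 3 ≤ 144 Cτ² c₁ √Z L^{3η}
  have hb3 : 2 * Cτ * (4 * Z + 3) ^ η * ((2 * (⌊Real.sqrt (4 * Z + 2)⌋₊ : ℝ) + 1) *
      (4 * Cτ * (4 * Z + 3) ^ η * (3 * (1 + Real.log (⌊Real.sqrt (4 * Z + 2)⌋₊ + 1))))) ≤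
      144 * Cτ ^ 2 * c₁ * Real.sqrt Z * L ^ (3 * η) := by
    have hlog0 : 0 ≤ 1 + Real.log (⌊Real.sqrt (4 * Z + 2)⌋₊ + 1) := by
      have : (0:ℝ) ≤ Real.log (⌊Real.sqrt (4 * Z + 2)⌋₊ + 1) := Real.log_nonneg (by linarith [(Nat.cast_nonneg _ : (0:ℝ) ≤ ⌊Real.sqrt (4 * Z + 2)⌋₊)])
      linarith
    have hp0 : 0 ≤ (4 * Z + 3) ^ η := by positivity
    -- rewrite as a product of the five bounded factors
    have e : 2 * Cτ * (4 * Z + 3) ^ η * ((2 * (⌊Real.sqrt (4 * Z + 2)⌋₊ : ℝ) + 1) *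
        (4 * Cτ * (4 * Z + 3) ^ η * (3 * (1 + Real.log (⌊Real.sqrt (4 * Z + 2)⌋₊ + 1))))) =
        24 * Cτ ^ 2 * (((4 * Z + 3) ^ η * (4 * Z + 3) ^ η) *
          ((2 * (⌊Real.sqrt (4 * Z + 2)⌋₊ : ℝ) + 1) * (1 + Real.log (⌊Real.sqrt (4 * Z + 2)⌋₊ + 1)))) := by
      ring
    rw [e]
    have hq1 : (4 * Z + 3) ^ η * (4 * Z + 3) ^ η ≤ L ^ η * L ^ η :=
      mul_le_mul hpow3 hpow3 hp0 hLη0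
    have hq2 : (2 * (⌊Real.sqrt (4 * Z + 2)⌋₊ : ℝ) + 1) * (1 + Real.log (⌊Real.sqrt (4 * Z + 2)⌋₊ + 1)) ≤
        (6 * Real.sqrt Z) * (c₁ * L ^ η) := mul_le_mul hA hlog3 hlog0 (by positivity)
    have hq : ((4 * Z + 3) ^ η * (4 * Z + 3) ^ η) *
        ((2 * (⌊Real.sqrt (4 * Z + 2)⌋₊ : ℝ) + 1) * (1 + Real.log (⌊Real.sqrt (4 * Z + 2)⌋₊ + 1))) ≤
        (L ^ η * L ^ η) * ((6 * Real.sqrt Z) * (c₁ * L ^ η)) :=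
      mul_le_mul hq1 hq2 (by positivity) (by positivity)
    have e2 : (L ^ η * L ^ η) * ((6 * Real.sqrt Z) * (c₁ * L ^ η)) = 6 * c₁ * Real.sqrt Z * L ^ (3 * η) := by
      rw [← hL3η']; ring
    rw [e2] at hq
    calc 24 * Cτ ^ 2 * (((4 * Z + 3) ^ η * (4 * Z + 3) ^ η) *
          ((2 * (⌊Real.sqrt (4 * Z + 2)⌋₊ : ℝ) + 1) * (1 + Real.log (⌊Real.sqrt (4 * Z + 2)⌋₊ + 1))))
        ≤ 24 * Cτ ^ 2 * (6 * c₁ * Real.sqrt Z * L ^ (3 * η)) :=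
          mul_le_mul_of_nonneg_left hq (by positivity)
      _ = 144 * Cτ ^ 2 * c₁ * Real.sqrt Z * L ^ (3 * η) := by ring
  -- total
  have hC2 : (1 : ℝ) ≤ Cτ ^ 2 := one_le_pow₀ hCτ1
  have hc₁0 : 0 ≤ c₁ := by linarith
  have hQR : (0 : ℝ) ≤ Q * (1 + R) := by positivity
  have hRi : (0 : ℝ) ≤ R⁻¹ := by positivity
  have hL3 : (0 : ℝ) ≤ L ^ (3 * η) := by positivity
  have hk1 : (24 : ℝ) * c₁ ≤ 144 * Cτ ^ 2 * c₁ := by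
    have : 0 ≤ (144 * Cτ ^ 2 - 24) * c₁ := mul_nonneg (by linarith) hc₁0
    linarith
  have hk2 : 24 * Cτ * c₁ ≤ 144 * Cτ ^ 2 * c₁ := by
    have h6 : 0 ≤ 24 * Cτ * c₁ * (6 * Cτ - 1) := mul_nonneg (by positivity) (by linarith)
    have : 144 * Cτ ^ 2 * c₁ - 24 * Cτ * c₁ = 24 * Cτ * c₁ * (6 * Cτ - 1) := by ring
    linarith
  have e1 : 24 * c₁ * (Q * (1 + R)) * L ^ (3 * η) ≤ 144 * Cτ ^ 2 * c₁ * (Q * (1 + R)) * L ^ (3 * η) :=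
    mul_le_mul_of_nonneg_right (mul_le_mul_of_nonneg_right hk1 hQR) hL3
  have e2 : 24 * Cτ * c₁ * R⁻¹ * L ^ (3 * η) ≤ 144 * Cτ ^ 2 * c₁ * R⁻¹ * L ^ (3 * η) :=
    mul_le_mul_of_nonneg_right (mul_le_mul_of_nonneg_right hk2 hRi) hL3
  have e3 : 144 * Cτ ^ 2 * c₁ * L ^ (3 * η) * (Q * (1 + R) + R⁻¹ + Real.sqrt Z) ≤
      144 * Cτ ^ 2 * c₁ * L ^ ε * (Q * (1 + R) + R⁻¹ + Real.sqrt Z) :=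
    mul_le_mul_of_nonneg_right (mul_le_mul_of_nonneg_left hLε (by positivity)) (by positivity)
  have e4 : 144 * Cτ ^ 2 * c₁ * (Q * (1 + R)) * L ^ (3 * η) + (144 * Cτ ^ 2 * c₁ * R⁻¹ * L ^ (3 * η) +
      144 * Cτ ^ 2 * c₁ * Real.sqrt Z * L ^ (3 * η)) =
      144 * Cτ ^ 2 * c₁ * L ^ (3 * η) * (Q * (1 + R) + R⁻¹ + Real.sqrt Z) := by ring
  have hfinal : 24 * c₁ * (Q * (1 + R)) * L ^ (3 * η) + (24 * Cτ * c₁ * R⁻¹ * L ^ (3 * η) +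
      144 * Cτ ^ 2 * c₁ * Real.sqrt Z * L ^ (3 * η)) ≤
      144 * Cτ ^ 2 * c₁ * L ^ ε * (Q * (1 + R) + R⁻¹ + Real.sqrt Z) :=
    calc _ ≤ 144 * Cτ ^ 2 * c₁ * (Q * (1 + R)) * L ^ (3 * η) + (144 * Cτ ^ 2 * c₁ * R⁻¹ * L ^ (3 * η) +
          144 * Cτ ^ 2 * c₁ * Real.sqrt Z * L ^ (3 * η)) := add_le_add e1 (add_le_add e2 le_rfl)
      _ = _ := e4
      _ ≤ _ := e3
  exact (add_le_add h1 (add_le_add h2 h3)).trans ((add_le_add hb1 (add_le_add hb2 hb3)).trans hfinal)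

end GM2025

end Literature.NumberTheory.Sieve

end
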